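import Literature.MathematicalPhysics.QuantumLattice.TorusLimitOfMixturesCompactness
import HarnessLib

/-!
# From torus-limit bounds to `limsup` bounds on finite tori (mixtures): the second half of the passage

Topic `Literature/MathematicalPhysics/QuantumLattice`; companion of `TorusLimitOfMixturesCompactness.lean`
(`InfVolFermionState.exists_isTorusLimitOfMixture_subseq`: every `Ls → ∞` has a subsequence along which the
weighted translation-averaged expectations of a family of finite mixtures converge to an infinite-volume state).
A certificate in the torus-limit thermal convention bounds `Re ω_Λ(A)` for EVERY torus limit `ω` of a mixture
family (e.g. the canonical Gibbs states of the `t–t'` Hubbard tori, `TorusSectorGibbsMixture.lean`). This file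
turns such a bound into the statement about FINITE tori that downstream consumers (stiffness / `T_c` hooks,
phase-map cells) quantify over:

* `InfVolFermionState.eventually_re_mixtureAvg_le_of_forall_isTorusLimitOfMixture` — if `Re ω_Λ(A) ≤ b` for
  every torus limit `ω` of the mixtures `(p_{L,i}, ψ_{L,i})` along every `Ls → ∞`, then for every `ε > 0`,
  EVENTUALLY IN `L`, `Re Σ_i p_{L,i} · torusAvgExpect L Λ A ψ_{L,i} ≤ b + ε` (i.e. `limsup_L ≤ b`). Proof by
  contradiction: a violating sequence of sides (`Filter.extraction_of_frequently_atTop`) has, by compactness, a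
  subsequence with a torus limit `ω`, along which the averages converge to `ω_Λ(A)` with `Re ω_Λ(A) ≤ b` — but
  every term exceeds `b + ε`.
* `…_ge_…` — the mirror statement for lower bounds.
* `eventually_re_sectorGibbsAvg_le_of_forall_torusLimit` / `…_ge_…` — by name for the canonical sector Gibbs data
  `(sectorGibbsWeightTT' β t t' U n L, sectorGibbsVectorTT' t t' U n L)` (`0 ≤ n ≤ 2`).

Everything is PROVED; no definition, no named fact. No `ε` can be dropped in general (the finite-volume values
may exceed their limit); consumers take `b + ε` with `ε` free (e.g. the `T_c` hooks of
`Summits/Ventures/…/StiffnessThermalSectorGibbsBridge.lean` accept exactly this `∀ ε > 0, ∀ᶠ L` shape).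

References: Bratteli–Robinson I Thm. 2.3.15, §4.3.1 [BratteliRobinsonI1987]; Israel 1979 §III.1 [Israel1979];
Simon, *The Statistical Mechanics of Lattice Gases* I (1993) §III.2 (limit points of periodic states). 
-/

noncomputable section

namespace Literature.MathematicalPhysics.QuantumLattice

open Matrix Finset HubbardWave0 Literature.Probability.LatticeModels ThermodynamicLimit
open _root_.Filter
open scoped _root_.Topology ComplexOrder BigOperators

section Limsup

variable {d : ℕ}

/-- **Torus-limit upper bounds are `limsup` bounds on finite tori.** Let `(p_{L,i}, ψ_{L,i})_{i < m L}` be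
finite mixtures of unit torus vectors with probability weights (at every side `L`), `A ∈ 𝔄_Λ` a local
observable and `b` a real number such that `Re ω_Λ(A) ≤ b` for EVERY infinite-volume state `ω` that is a torus
limit of the mixtures along some `Ls → ∞`. Then for every `ε > 0`, eventually in `L`,
`Re Σ_i p_{L,i} · torusAvgExpect L Λ A ψ_{L,i} ≤ b + ε`.
[cite: BratteliRobinsonI1987, Thm. 2.3.15 (weak-⋆ compactness of the state space) and §4.3.1] -/
theorem InfVolFermionState.eventually_re_mixtureAvg_le_of_forall_isTorusLimitOfMixture {m : ℕ → ℕ}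
    (p : ∀ L, Fin (m L) → ℝ) (ψ : ∀ L, Fin (m L) → Fock (Orb (FermionTorus d L)))
    (hp0 : ∀ L i, 0 ≤ p L i) (hp1 : ∀ L, ∑ i, p L i = 1) (hψ : ∀ L i, star (ψ L i) ⬝ᵥ ψ L i = 1)
    (Λ : Finset (Site d)) (A : FermionOp Λ) {b : ℝ}
    (hbound : ∀ (ω : InfVolFermionState d) (Ls : ℕ → ℕ), Tendsto Ls atTop atTop →
      ω.IsTorusLimitOfMixture m p ψ Ls → (ω.expect Λ A).re ≤ b)
    {ε : ℝ} (hε : 0 < ε) :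
    ∀ᶠ L in atTop, (∑ i, (p L i : ℂ) * torusAvgExpect L Λ A (ψ L i)).re ≤ b + ε := by
  by_contra hnot
  obtain ⟨Ls, hLsmono, hLs⟩ := extraction_of_frequently_atTop (Filter.not_eventually.1 hnot)
  have hLt : Tendsto Ls atTop atTop := hLsmono.tendsto_atTop
  obtain ⟨φ, hφ, ω, hω⟩ := InfVolFermionState.exists_isTorusLimitOfMixture_subseq p ψ hLt
    (fun j i => hp0 _ i) (fun j => hp1 _) (fun j i => hψ _ i)
  have hb : (ω.expect Λ A).re ≤ b := hbound ω (Ls ∘ φ) (hLt.comp hφ.tendsto_atTop) hω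
  have hconv : Tendsto
      (fun j => (∑ i, (p (Ls (φ j)) i : ℂ) * torusAvgExpect (Ls (φ j)) Λ A (ψ (Ls (φ j)) i)).re)
      atTop (𝓝 ((ω.expect Λ A).re)) :=
    (Complex.continuous_re.tendsto _).comp (hω Λ A)
  have hgt : ∀ j, b + ε ≤ (∑ i, (p (Ls (φ j)) i : ℂ) * torusAvgExpect (Ls (φ j)) Λ A (ψ (Ls (φ j)) i)).re :=
    fun j => (lt_of_not_ge (hLs (φ j))).le
  have hle : b + ε ≤ (ω.expect Λ A).re := ge_of_tendsto' hconv hgt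
  linarith

/-- **Torus-limit lower bounds are `liminf` bounds on finite tori** (mirror of the previous theorem):
`b ≤ Re ω_Λ(A)` for every torus limit ⇒ `∀ ε > 0`, eventually in `L`,
`b − ε ≤ Re Σ_i p_{L,i} · torusAvgExpect L Λ A ψ_{L,i}`.
[cite: BratteliRobinsonI1987, Thm. 2.3.15 (weak-⋆ compactness of the state space) and §4.3.1] -/
theorem InfVolFermionState.eventually_re_mixtureAvg_ge_of_forall_isTorusLimitOfMixture {m : ℕ → ℕ}
    (p : ∀ L, Fin (m L) → ℝ) (ψ : ∀ L, Fin (m L) → Fock (Orb (FermionTorus d L)))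
    (hp0 : ∀ L i, 0 ≤ p L i) (hp1 : ∀ L, ∑ i, p L i = 1) (hψ : ∀ L i, star (ψ L i) ⬝ᵥ ψ L i = 1)
    (Λ : Finset (Site d)) (A : FermionOp Λ) {b : ℝ}
    (hbound : ∀ (ω : InfVolFermionState d) (Ls : ℕ → ℕ), Tendsto Ls atTop atTop →
      ω.IsTorusLimitOfMixture m p ψ Ls → b ≤ (ω.expect Λ A).re)
    {ε : ℝ} (hε : 0 < ε) :
    ∀ᶠ L in atTop, b - ε ≤ (∑ i, (p L i : ℂ) * torusAvgExpect L Λ A (ψ L i)).re := by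
  by_contra hnot
  obtain ⟨Ls, hLsmono, hLs⟩ := extraction_of_frequently_atTop (Filter.not_eventually.1 hnot)
  have hLt : Tendsto Ls atTop atTop := hLsmono.tendsto_atTop
  obtain ⟨φ, hφ, ω, hω⟩ := InfVolFermionState.exists_isTorusLimitOfMixture_subseq p ψ hLt
    (fun j i => hp0 _ i) (fun j => hp1 _) (fun j i => hψ _ i)
  have hb : b ≤ (ω.expect Λ A).re := hbound ω (Ls ∘ φ) (hLt.comp hφ.tendsto_atTop) hω
  have hconv : Tendsto
      (fun j => (∑ i, (p (Ls (φ j)) i : ℂ) * torusAvgExpect (Ls (φ j)) Λ A (ψ (Ls (φ j)) i)).re)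
      atTop (𝓝 ((ω.expect Λ A).re)) :=
    (Complex.continuous_re.tendsto _).comp (hω Λ A)
  have hlt : ∀ j, (∑ i, (p (Ls (φ j)) i : ℂ) * torusAvgExpect (Ls (φ j)) Λ A (ψ (Ls (φ j)) i)).re ≤ b - ε :=
    fun j => (lt_of_not_ge (hLs (φ j))).le
  have hle : (ω.expect Λ A).re ≤ b - ε := le_of_tendsto' hconv hlt
  linarith

end Limsup

/-! ### By name for the canonical sector Gibbs data of the `t–t'` Hubbard tori -/

section SectorGibbs

/-- **Thermal torus-limit upper bounds are `limsup` bounds on the finite-volume canonical Gibbs states.**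
For the canonical Gibbs data of `hubbardTorusTT' L t t' U` on the sectors `(rectN n L, S^z = 0)` (`0 ≤ n ≤ 2`)
at inverse temperature `β`: if `Re ω_Λ(A) ≤ b` for every torus limit `ω` of these mixtures (along every
`Ls → ∞`), then `∀ ε > 0`, eventually in `L`,
`Re Σ_i p_{L,i}(β) · torusAvgExpect L Λ A ψ_{L,i} ≤ b + ε`. [cite: Israel1979, §I.3 eq. (26)] -/
theorem eventually_re_sectorGibbsAvg_le_of_forall_torusLimit (t t' U : ℝ) {n : ℝ} (hn0 : 0 ≤ n)
    (hn2 : n ≤ 2) (β : ℝ) (Λ : Finset (Site 2)) (A : FermionOp Λ) {b : ℝ}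
    (hbound : ∀ (ω : InfVolFermionState 2) (Ls : ℕ → ℕ), Tendsto Ls atTop atTop →
      ω.IsTorusLimitOfMixture (sectorGibbsCount n) (fun L => sectorGibbsWeightTT' β t t' U n L)
        (fun L => sectorGibbsVectorTT' t t' U n L) Ls → (ω.expect Λ A).re ≤ b)
    {ε : ℝ} (hε : 0 < ε) :
    ∀ᶠ L in atTop, (∑ i, (sectorGibbsWeightTT' β t t' U n L i : ℂ) *
        torusAvgExpect L Λ A (sectorGibbsVectorTT' t t' U n L i)).re ≤ b + ε :=
  InfVolFermionState.eventually_re_mixtureAvg_le_of_forall_isTorusLimitOfMixture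
    (fun L => sectorGibbsWeightTT' β t t' U n L) (fun L => sectorGibbsVectorTT' t t' U n L)
    (fun L i => sectorGibbsWeightTT'_nonneg β t t' U n L i)
    (fun L => sum_sectorGibbsWeightTT' β t t' U hn0 hn2 L)
    (fun L i => star_sectorGibbsVectorTT'_dotProduct_self t t' U n L i) Λ A hbound hε

/-- **Thermal torus-limit lower bounds are `liminf` bounds on the finite-volume canonical Gibbs states**
(mirror form). [cite: Israel1979, §I.3 eq. (26)] -/
theorem eventually_re_sectorGibbsAvg_ge_of_forall_torusLimit (t t' U : ℝ) {n : ℝ} (hn0 : 0 ≤ n)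
    (hn2 : n ≤ 2) (β : ℝ) (Λ : Finset (Site 2)) (A : FermionOp Λ) {b : ℝ}
    (hbound : ∀ (ω : InfVolFermionState 2) (Ls : ℕ → ℕ), Tendsto Ls atTop atTop →
      ω.IsTorusLimitOfMixture (sectorGibbsCount n) (fun L => sectorGibbsWeightTT' β t t' U n L)
        (fun L => sectorGibbsVectorTT' t t' U n L) Ls → b ≤ (ω.expect Λ A).re)
    {ε : ℝ} (hε : 0 < ε) :
    ∀ᶠ L in atTop, b - ε ≤ (∑ i, (sectorGibbsWeightTT' β t t' U n L i : ℂ) *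
        torusAvgExpect L Λ A (sectorGibbsVectorTT' t t' U n L i)).re :=
  InfVolFermionState.eventually_re_mixtureAvg_ge_of_forall_isTorusLimitOfMixture
    (fun L => sectorGibbsWeightTT' β t t' U n L) (fun L => sectorGibbsVectorTT' t t' U n L)
    (fun L i => sectorGibbsWeightTT'_nonneg β t t' U n L i)
    (fun L => sum_sectorGibbsWeightTT' β t t' U hn0 hn2 L)
    (fun L i => star_sectorGibbsVectorTT'_dotProduct_self t t' U n L i) Λ A hbound hε

end SectorGibbs

/-! ### Finite-volume rows pass to torus limits

The converse bookkeeping: an inequality that holds (up to `ε`, eventually in `L`) between the weighted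
energy per site, the weighted translation average of a local observable and a convergent reference sequence
(e.g. the sector ground-energy density) along the finite tori holds between their limits for every torus limit
— how a row PROVED AT FINITE VOLUME (entropy / free-energy rows of the canonical Gibbs states, …) enters the
torus-limit certificate reader as an extra row. -/

section RowPassage

/-- **Finite-volume rows pass to mixture torus limits.** Let `ω` be a torus limit of the mixtures
`(p_{L,i}, ψ_{L,i})` along `Ls → ∞`, `A ∈ 𝔄_Λ`, `a, κ, c` reals and `g : ℕ → ℝ` a reference sequence with
`g L → γ`. If for every `ε > 0`, eventually in `L`,
`a · Σ_i p_{L,i} Re⟨ψ_{L,i}, H_L(t,t',U) ψ_{L,i}⟩/L² + κ · Re Σ_i p_{L,i} torusAvgExpect L Λ A ψ_{L,i} ≤ g L + c + ε`,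
then `a · e_{Φ(t,t',U)}(ω) + κ · Re ω_Λ(A) ≤ γ + c` (`tendsto_meanEnergy_hubbardTTPrime`, the defining
convergence of `ω_Λ(A)`, `le_of_tendsto_of_tendsto`). [cite: BratteliRobinsonI1987, §4.3.1 (PDF pp. 373–375)] -/
theorem InfVolFermionState.IsTorusLimitOfMixture.mul_meanEnergy_add_mul_re_expect_le_of_eventually
    (t t' U : ℝ) {ω : InfVolFermionState 2} {m : ℕ → ℕ} {p : ∀ L, Fin (m L) → ℝ}
    {ψ : ∀ L, Fin (m L) → Fock (Orb (FermionTorus 2 L))} {Ls : ℕ → ℕ}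
    (h : ω.IsTorusLimitOfMixture m p ψ Ls) (hLs : Tendsto Ls atTop atTop)
    (Λ : Finset (Site 2)) (A : FermionOp Λ) {a κ c γ : ℝ} {g : ℕ → ℝ} (hg : Tendsto g atTop (𝓝 γ))
    (hfin : ∀ ε : ℝ, 0 < ε → ∀ᶠ L in atTop,
      a * (∑ i, p L i * ((QuantumLattice.expect (hubbardTorusTT' L t t' U) (ψ L i)).re / (L : ℝ) ^ 2)) +
          κ * (∑ i, (p L i : ℂ) * torusAvgExpect L Λ A (ψ L i)).re ≤ g L + c + ε) :
    a * ω.meanEnergy (hubbardTTPrimeFermionInteraction t t' U) 1 + κ * (ω.expect Λ A).re ≤ γ + c := by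
  have hE := h.tendsto_meanEnergy_hubbardTTPrime t t' U hLs
  have hA : Tendsto (fun j => (∑ i, (p (Ls j) i : ℂ) * torusAvgExpect (Ls j) Λ A (ψ (Ls j) i)).re) atTop
      (𝓝 ((ω.expect Λ A).re)) := (Complex.continuous_re.tendsto _).comp (h Λ A)
  have hF := (hE.const_mul a).add (hA.const_mul κ)
  have hεle : ∀ ε : ℝ, 0 < ε →
      a * ω.meanEnergy (hubbardTTPrimeFermionInteraction t t' U) 1 + κ * (ω.expect Λ A).re ≤ γ + c + ε := by
    intro ε hε
    have hG : Tendsto (fun j => g (Ls j) + c + ε) atTop (𝓝 (γ + c + ε)) :=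
      ((hg.comp hLs).add_const c).add_const ε
    exact le_of_tendsto_of_tendsto hF hG (hLs.eventually (hfin ε hε))
  by_contra hlt
  push Not at hlt
  have h2 := hεle ((a * ω.meanEnergy (hubbardTTPrimeFermionInteraction t t' U) 1 + κ * (ω.expect Λ A).re -
    (γ + c)) / 2) (by linarith)
  linarith

/-- **Finite-volume rows of the canonical Gibbs states pass to thermal torus limits** (reference sequence
= `b ×` the sector ground-energy density, `→ b · e(t,t',U,n)` by `tendsto_energyDensityTT'_torus`; `U ≥ 0`,
`0 ≤ n < 2`). If for every `ε > 0`, eventually in `L`,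
`a · E_β(L)/L² + κ · Re Σ_i p_{L,i}(β) torusAvgExpect L Λ A ψ_{L,i} ≤ b · E₀(L; rectN n L)/L² + c + ε`
(`E_β(L) = Σ_i p_{L,i}(β) Re⟨ψ_{L,i}, H_L ψ_{L,i}⟩` the canonical Gibbs energy), then for every torus limit `ω`
of the canonical sector Gibbs states along any `Ls → ∞`:
`a · e_Φ(ω) + κ · Re ω_Λ(A) ≤ b · e(t,t',U,n) + c`. With `a = 1`, `κ = −1/(β|B|)`, `A` = an entropy
witness `G̃ ∈ 𝔄_B`, `b = 1`, `c = (log Tr e^{−G})/(β|B|)` this is the torus-limit form of an «entropy row»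
`e − (1/(β|B|))⟨G̃⟩ ≤ e₀ + c` once it is proved on the finite tori. [cite: Israel1979, §I.3 eq. (26)] -/
theorem InfVolFermionState.IsTorusLimitOfMixture.mul_meanEnergy_add_mul_re_expect_le_of_eventually_sectorGibbs
    (t t' : ℝ) {U : ℝ} (hU : 0 ≤ U) {n : ℝ} (hn0 : 0 ≤ n) (hn2 : n < 2) (β : ℝ)
    {ω : InfVolFermionState 2} {Ls : ℕ → ℕ}
    (h : ω.IsTorusLimitOfMixture (sectorGibbsCount n) (fun L => sectorGibbsWeightTT' β t t' U n L)
      (fun L => sectorGibbsVectorTT' t t' U n L) Ls)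
    (hLs : Tendsto Ls atTop atTop) (Λ : Finset (Site 2)) (A : FermionOp Λ) {a κ b c : ℝ}
    (hfin : ∀ ε : ℝ, 0 < ε → ∀ᶠ L in atTop,
      a * (∑ i, sectorGibbsWeightTT' β t t' U n L i *
            ((QuantumLattice.expect (hubbardTorusTT' L t t' U) (sectorGibbsVectorTT' t t' U n L i)).re /
              (L : ℝ) ^ 2)) +
          κ * (∑ i, (sectorGibbsWeightTT' β t t' U n L i : ℂ) *
            torusAvgExpect L Λ A (sectorGibbsVectorTT' t t' U n L i)).re ≤
        b * (groundEnergy (hubbardTorusTT' L t t' U) (rectN n L) / (L : ℝ) ^ 2) + c + ε) :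
    a * ω.meanEnergy (hubbardTTPrimeFermionInteraction t t' U) 1 + κ * (ω.expect Λ A).re ≤
      b * energyDensityTT' t t' U n + c :=
  h.mul_meanEnergy_add_mul_re_expect_le_of_eventually t t' U hLs Λ A
    (((tendsto_energyDensityTT'_torus t t' hU hn0 hn2).const_mul b)) hfin

end RowPassage

end Literature.MathematicalPhysics.QuantumLattice

end
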